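import Literature.AnabelianGeometry.EtaleTheta.DivisorMonoidsConstants
import Literature.AnabelianGeometry.EtaleTheta.Discharge.Sec4NonVacuityCovering

/-!
# [EtTh] Def. 3.1 (i)(ii) / Def. 3.3 (iii): "divisors of constants are non-cuspidal"
# (`DivisorMonoids.CnstNonCuspidal`) is a SCHEMA over the Def. 3.3 (iii) data — kernel truth table
# (FACT-LIST row F-2791; proof-only companion of `DivisorMonoidsConstants.lean`)

S. Mochizuki, *The étale theta function and its Frobenioid-theoretic manifestations*, Publ. RIMS **45**
(2009) [MochizukiEtTh2009], Def. 3.1 (i)(ii), PDF p. 70 (printed 296): a log-divisor is "non-cuspidal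
if [its] support lies in the special fiber"; the "constant log-meromorphic functions" are those "arising
from `L^×`" — so in print the log-divisor of a constant `c ∈ L^×` is `v(c)`·(special fibre), a difference
of non-cuspidal effective log-divisors [cite: MochizukiEtTh2009, Def 3.1 p.70]; Def. 3.3 (iii), PDF p. 73:
`F₀ ⊆ B₀`, `Φ₀^cnst :=` the image of `F₀` in `Φ₀^gp` [cite: MochizukiEtTh2009, Def 3.3 p.73].

PROOF-ONLY file (abc-iut cell, block F fact-proving wave, seat abc-iut-f-145 floating after tranche 145;
FACT-LIST row **F-2791** `Literature.AnabelianGeometry.EtaleTheta.DivisorMonoids.CnstNonCuspidal`, in no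
tranche; status «model-witness» via the owner file's `Toy.cnstNonCuspidal`).  The named Prop is a
predicate on abc-iut-L2-t3's DATA structure `dm : DivisorMonoids D₀` (Def. 3.3 (iii): the functors
`Φ₀`, `B₀`, the divisor map `div₀ : B₀ → Φ₀^gp`, the constants `F₀ ⊆ B₀` and the non-cuspidal / cuspidal
submonoids `Φ₀^ncsp`, `Φ₀^csp` are FREE fields tied together only by the unique factorisation
`Φ₀ = Φ₀^ncsp · Φ₀^csp`).  Kernel truth table (plan FACT-LIST header, rule R5):

* `cnstNonCuspidal_iff_forall_cnst` — AS TYPED it says exactly: every element of `Φ₀^cnst(Y)` is a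
  fraction of two non-cuspidal elements;
* INSTANCE FORMS for whole classes of data: `cnstNonCuspidal_of_ncsp₀_eq_top` (every datum all of whose
  log-divisors are non-cuspidal — the shape of EVERY constructed datum in the tree: `Toy.divisorMonoids`
  — the owner file's `Toy.cnstNonCuspidal` is the case `Toy.divisorMonoids` —, abc-iut's Kummer-tower toy
  `ToyCov.divisorMonoids` (`ToyCov.cnstNonCuspidal` below), the two-primes / HNZ toys), `cnstNonCuspidal_of_F₀_eq_bot` (no
  constants: vacuous), `cnstNonCuspidal_of_div₀_F₀_eq_one` (constants with trivial divisor, e.g. units);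
* **`exists_not_cnstNonCuspidal` / `not_forall_cnstNonCuspidal`** — the SWAPPED toy over the one-object
  base (`Φ₀ = ℕ` with `Φ₀^ncsp := 1`, `Φ₀^csp := ℕ` — a legal unique factorisation —, `B₀ = ℤ`,
  `div₀(n) = 𝔭ⁿ`, `F₀ = B₀`): the constant `𝔭` has the CUSPIDAL divisor `𝔭 ≠ 1`, so the Prop fails; the
  universal closure over the interface is REFUTED.

So F-2791 is a SCHEMA: a constraint relating the free fields `F₀`, `div₀`, `ncsp₀` (what a construction of
the Def. 3.3 (iii) data from a curve satisfies — in print by Def. 3.1 (i)(ii)), admissible as a hypothesis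
on `dm` (the binder `hD1` genre of the Cor. 3.8 (iii) discharge) / at named instances, where it is a theorem
for every all-non-cuspidal datum.  HONEST FRAMING: statements about the TYPED predicate over abstract
interface data and the tree's degenerate toys; nothing of [EtTh] is asserted or denied; no side is taken on
[IUTchIII] Cor. 3.12; typed ≠ proved.  No definitions, no instances, no Prop facts.
-/

noncomputable section

namespace Literature.AnabelianGeometry.EtaleTheta

open CategoryTheory Opposite

universe u v w

namespace DivisorMonoids

variable {D₀ : Type u} [Category.{v} D₀] (dm : DivisorMonoids.{u, v, w} D₀)

/-! ### What the Prop says -/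

/-- `CnstNonCuspidal` in terms of the trunk's `Φ₀^cnst = div₀(F₀) ⊆ Φ₀^gp` (Def. 3.3 (iii)): every element of
`Φ₀^cnst(Y)` is a fraction `n₁ / n₂` of non-cuspidal elements. [cite: MochizukiEtTh2009, Def 3.3 p.73] -/
theorem cnstNonCuspidal_iff_forall_cnst :
    dm.CnstNonCuspidal ↔ ∀ (Y : D₀ᵒᵖ), ∀ c ∈ dm.cnst Y,
      ∃ n₁ ∈ dm.ncsp₀ Y, ∃ n₂ ∈ dm.ncsp₀ Y,
        c * Algebra.GrothendieckGroup.of n₂ = Algebra.GrothendieckGroup.of n₁ := by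
  constructor
  · rintro h Y _ ⟨b, hb, rfl⟩
    exact h Y b hb
  · intro h Y b hb
    exact h Y _ ⟨b, hb, rfl⟩

/-! ### Instance forms for whole classes of data -/

/-- **Every datum all of whose log-divisors are non-cuspidal satisfies `CnstNonCuspidal`** (`Φ₀^gp` consists
of fractions of elements of `Φ₀ = Φ₀^ncsp`).  This is the shape of every constructed Def. 3.3 (iii) datum in
the tree. [cite: MochizukiEtTh2009, Def 3.1 p.70] -/
theorem cnstNonCuspidal_of_ncsp₀_eq_top (h : ∀ Y : D₀ᵒᵖ, dm.ncsp₀ Y = ⊤) : dm.CnstNonCuspidal := by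
  intro Y b _
  obtain ⟨n₁, n₂, e⟩ := Literature.AlgebraicGeometry.Frobenioids.gp_exists_mul_of_eq_of (dm.div₀ Y b)
  refine ⟨n₁, ?_, n₂, ?_, e⟩
  · rw [h Y]; exact Submonoid.mem_top _
  · rw [h Y]; exact Submonoid.mem_top _

/-- A datum WITHOUT constants (`F₀ = 1`) satisfies `CnstNonCuspidal` vacuously. [cite: MochizukiEtTh2009, Def 3.3 p.73] -/
theorem cnstNonCuspidal_of_F₀_eq_bot (h : ∀ Y : D₀ᵒᵖ, dm.F₀ Y = ⊥) : dm.CnstNonCuspidal := by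
  intro Y b hb
  rw [h Y, Submonoid.mem_bot] at hb
  subst hb
  exact ⟨1, one_mem _, 1, one_mem _, by rw [map_one, map_one, one_mul]⟩

/-- A datum whose constants all have TRIVIAL divisor (e.g. `F₀ =` units only) satisfies `CnstNonCuspidal`.
[cite: MochizukiEtTh2009, Def 3.3 p.73] -/
theorem cnstNonCuspidal_of_div₀_F₀_eq_one (h : ∀ (Y : D₀ᵒᵖ) (b : dm.B₀.obj Y), b ∈ dm.F₀ Y → dm.div₀ Y b = 1) :
    dm.CnstNonCuspidal := fun Y b hb =>
  ⟨1, one_mem _, 1, one_mem _, by rw [h Y b hb, map_one, one_mul]⟩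

/-! ### The universal closure is REFUTED: the swapped toy -/

/-- `EtaleTheta.gpMap id = id`, pointwise. [folklore] -/
private theorem gpMap_id_apply {M : Type w} [CommMonoid M] (x : Algebra.GrothendieckGroup M) :
    EtaleTheta.gpMap (MonoidHom.id M) x = x := by
  obtain ⟨a, b, h⟩ := Literature.AlgebraicGeometry.Frobenioids.gp_exists_mul_of_eq_of x
  have hx : x = Algebra.GrothendieckGroup.of a / Algebra.GrothendieckGroup.of b := by
    rw [eq_div_iff_mul_eq', h]
  rw [hx, map_div, EtaleTheta.gpMap_of, EtaleTheta.gpMap_of, MonoidHom.id_apply, MonoidHom.id_apply]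

/-- **Countermodel for F-2791 — the swapped toy**: over the one-object base, `Φ₀ = ℕ` with `Φ₀^ncsp := 1` and
`Φ₀^csp := ℕ` (a legal unique factorisation `Φ₀ = Φ₀^ncsp · Φ₀^csp`), `B₀ = ℤ`, `div₀(n) = 𝔭ⁿ`, `F₀ = B₀`: the
constant `𝔭 ∈ F₀` has divisor `𝔭 = 𝔭 / 1` with `𝔭` CUSPIDAL and `≠ 1`, so `CnstNonCuspidal` fails.
[cite: MochizukiEtTh2009, Def 3.1 p.70] -/
theorem exists_not_cnstNonCuspidal :
    ∃ dm : DivisorMonoids.{0, 0, 0} (Discrete PUnit.{1}), ¬ dm.CnstNonCuspidal := by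
  refine ⟨{ Φ₀ := (Functor.const _).obj (CommMonCat.of (Multiplicative ℕ))
            B₀ := (Functor.const _).obj (CommMonCat.of (Multiplicative ℤ))
            isUnit_B₀ := fun _ b => by
              change IsUnit (M := Multiplicative ℤ) b
              exact Group.isUnit _
            div₀ := fun _ => Toy.divHom
            div₀_natural := fun _ b => (gpMap_id_apply (Toy.divHom b)).symm
            F₀ := fun _ => ⊤
            F₀_map := fun _ _ _ => trivial
            ncsp₀ := fun _ => ⊥
            csp₀ := fun _ => ⊤
            ncsp₀_map := fun _ x hx => by
              rw [Submonoid.mem_bot] at hx ⊢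
              rw [hx, map_one]
            csp₀_map := fun _ _ _ => trivial
            existsUnique_ncsp_csp := fun _ x => by
              refine ⟨(⟨1, Submonoid.mem_bot.mpr rfl⟩, ⟨x, trivial⟩), one_mul x, ?_⟩
              rintro ⟨a, c⟩ h
              have ha : a.1 = 1 := Submonoid.mem_bot.mp a.2
              have hc : c.1 = x := by
                have h' : a.1 * c.1 = x := h
                rwa [ha, one_mul] at h'
              exact Prod.ext (Subtype.ext ha) (Subtype.ext hc) }, fun h => ?_⟩
  -- read `h` at the base point on the concrete carriers
  have key : ∀ b : Multiplicative ℤ, b ∈ (⊤ : Submonoid (Multiplicative ℤ)) →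
      ∃ n₁ ∈ (⊥ : Submonoid (Multiplicative ℕ)), ∃ n₂ ∈ (⊥ : Submonoid (Multiplicative ℕ)),
        Toy.divHom b * Algebra.GrothendieckGroup.of n₂ = Algebra.GrothendieckGroup.of n₁ :=
    h (op ⟨PUnit.unit⟩)
  obtain ⟨n₁, hn₁, n₂, hn₂, e1⟩ := key (Multiplicative.ofAdd (1 : ℤ)) trivial
  rw [Submonoid.mem_bot] at hn₁ hn₂
  subst hn₁ hn₂
  -- `e1 : 𝔭 · 1 = 1` in `ℕ^gp`, i.e. `𝔭 = 1`: absurd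
  rw [map_one (Algebra.GrothendieckGroup.of (M := Multiplicative ℕ)), mul_one, Toy.divHom_ofAdd_one] at e1
  have e2 : Multiplicative.ofAdd (1 : ℕ) = 1 := by
    apply Algebra.GrothendieckGroup.of_injective
    rw [e1, map_one (Algebra.GrothendieckGroup.of (M := Multiplicative ℕ))]
  exact one_ne_zero (Multiplicative.ofAdd.injective e2)

/-- **F-2791, universal closure REFUTED**: it is NOT the case that every Def. 3.3 (iii) datum satisfies
`CnstNonCuspidal` — the Prop is a SCHEMA (a constraint on the free fields `F₀`, `div₀`, `Φ₀^ncsp`),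
admissible as a hypothesis on `dm` / at named instances only. [cite: MochizukiEtTh2009, Def 3.1 p.70] -/
theorem not_forall_cnstNonCuspidal :
    ¬ ∀ (D₀ : Type) [Category.{0} D₀] (dm : DivisorMonoids.{0, 0, 0} D₀), dm.CnstNonCuspidal := fun h => by
  obtain ⟨dm, hdm⟩ := exists_not_cnstNonCuspidal
  exact hdm (h _ dm)

end DivisorMonoids

/-! ### Named instances -/

/-- **F-2791 at abc-iut's Kummer-tower toy** (`ToyCov.divisorMonoids`: `Φ₀ = ℚ_{≥0}`, `B₀ = ℂˣ × (ℚ_{≥0})^gp`,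
everything non-cuspidal): `CnstNonCuspidal` HOLDS. [cite: MochizukiEtTh2009, Def 3.1 p.70] -/
theorem ToyCov.cnstNonCuspidal : ToyCov.divisorMonoids.CnstNonCuspidal :=
  ToyCov.divisorMonoids.cnstNonCuspidal_of_ncsp₀_eq_top fun _ => rfl

end Literature.AnabelianGeometry.EtaleTheta

end
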